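import Summits.ValiantsHypothesis.ValiantsHypothesis.Theorems.LacunarySymmetroidMatrixDescartesDoorA26WallBubblingBalanceCount

/-!
# `DoorA26` / line `wall_bubbling` — NO-BALANCE KIT: test matrices, proportional null letters, the Lorentz cross product, and
«six parallel touches are impossible»

HONEST FRAMING.  Object-search cell `pub-symmetroid`, crux `Theses.LacunarySymmetroid.DoorA26` (stmt-ValiantsHypothesis-19979; OPEN, typed,
never asserted).  W2 seat val-sym-door-p1 g19, file #53; def-free helper for obligation (R) of `Cruxes/DoorA26/Lines/wall_bubbling.lean`, continuing
#47 `…FirstOrderDual` (`mem_twentyLocus_of_touches_noBalance`: a rank-one touch profile lifts to a twenty unless it is BALANCED — weights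
`μ ≥ 0` on the touch set, not all zero, with `Σ_j μ_j κ_j e^{δ_l τ_j} P(τ_j) = 0` for all six `l`) and #48 `…BalanceCount`.  This file is the
algebra half of the proof (files #53–#55) that BALANCED PROFILES DO NOT EXIST.

WHAT IS HERE (all about the polar form `polar` of the `2 × 2` determinant on `Sym₂ℝ ≅ ℝ^{1,2}`, copied verbatim from the line file in
`…BubblingDefs`).  §1 (on top of `Bubbling.polar_apply/polar_comm/polar_self` of `…BubblingNormalisation`) `polar_add_right`, `polar_zero_right`, `polar_smul_right`,
`polar_sum_smul`, `polar_one_left` (`polar 1 P = tr P / 2`), `polar_expPencil` (`polar(β, P(t)) = Σ_l polar(β,S_l) e^{δ_l t}` is a six-term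
sum) and ★ `balance_pairing`: pairing the six matrix balance equations with ANY test matrix `β` gives a KERNEL VECTOR
`j ↦ μ_j κ_j polar(β, P(τ_j))` of the exponential point evaluations (the currency of #48).  §2 `exists_eq_smul_of_polar_eq_zero` (two singular
symmetric letters with `polar = 0` are proportional: orthogonal null vectors are parallel), `exists_eq_smul_of_three_polar` + `three_polar_self`
(a letter orthogonal to the three explicit test matrices `!![2p₀₁, p₁₁; p₁₁, 0]`, `!![0, p₀₀; p₀₀, 2p₀₁]`, `p` of a null letter `p` is a multiple of
`p`: `(p^⊥)^⊥ = ℝp`), the LORENTZ CROSS PRODUCT `β(p,q) = !![2(p₀₀q₀₁ − p₀₁q₀₀), p₀₀q₁₁ − p₁₁q₀₀; p₀₀q₁₁ − p₁₁q₀₀, 2(p₀₁q₁₁ − p₁₁q₀₁)]`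
(`polar_cross_left_right`: orthogonal to `p` and `q`), the GRAM IDENTITY `polar_cross_sq` (`polar(β(p,q),r)² = 8·polar(p,q)polar(q,r)polar(r,p)
+ 4(det p det q det r − det p·polar(q,r)² − det q·polar(r,p)² − det r·polar(p,q)²)` — `det(XᵀMX) = det M·det X²` for the coordinate matrix `X` of
`p, q, r`) and its corollary `polar_eq_zero_or_of_cross` (a null letter orthogonal to `β(p,q)` for non-orthogonal null `p, q` is parallel to `p` or to
`q`: the plane `span(p,q)` holds exactly two null lines).  §3 `expCoeff_eq_zero_of_zeros` (a `K`-term real exponential sum with `K` distinct zeros has all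
coefficients zero — left kernel of the non-singular matrix of #46 `det_exp_ne_zero`) and ★ `false_of_parallel_touches`: if at `≥ 6` abscissae the pencil
values are multiples of ONE singular symmetric `p` with `tr p ≠ 0` while `det P ≠ 0` somewhere, contradiction (each test matrix `⊥ p` kills every
letter, so every letter is a multiple of `p` and `det P ≡ 0`).
READING for (R): with #54 (sign cuts) and #55 (`noBalance_of_rankOne`, `mem_twentyLocus_of_rankOne_touches`) the rank-one multiplicity residual of #47/#48
(«balanced profiles with 7 ≤ |J| ≤ 10 touches») is EMPTY for honestly encoded profiles.  Nothing here bears on `DoorA26`, `DoorA34`, (W)/(M)/(R) as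
typed, `MatrixDescartes` (18050) or `VP ≠ VNP`; registers unchanged.

[folklore] polar form of the `2 × 2` determinant; `(Sym₂ℝ, det) ≅ ℝ^{1,2}` (two null vectors are orthogonal iff parallel; a plane through two
null lines contains no third; Gram determinant = `det M · det X²`); linear independence of `K` exponentials at `K` nodes.  [this work] the packaging.
-/

set_option linter.dupNamespace false

namespace Summit.ValiantsHypothesis.ValiantsHypothesis.Theorems.LacunarySymmetroidMatrixDescartes.WallBubbling

open Finset
open Bubbling (polar polar_apply polar_comm polar_self)

/-! ## §1 The polar pairing in entries; pairing the balance equations with a test matrix -/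

/-- `polar β` is additive in the right slot. [folklore] -/
theorem polar_add_right (β P Q : Matrix (Fin 2) (Fin 2) ℝ) : polar β (P + Q) = polar β P + polar β Q := by
  simp only [polar_apply, Matrix.add_apply]; ring

/-- `polar β 0 = 0`. [folklore] -/
theorem polar_zero_right (β : Matrix (Fin 2) (Fin 2) ℝ) : polar β 0 = 0 := by
  simp only [polar_apply, Matrix.zero_apply]; ring

/-- `polar β (c • P) = c · polar β P`. [folklore] -/
theorem polar_smul_right (β P : Matrix (Fin 2) (Fin 2) ℝ) (c : ℝ) : polar β (c • P) = c * polar β P := by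
  simp only [polar_apply, Matrix.smul_apply, smul_eq_mul]; ring

/-- `polar β` is linear: it passes through a weighted sum of matrices. [folklore] -/
theorem polar_sum_smul {ι : Type*} (s : Finset ι) (β : Matrix (Fin 2) (Fin 2) ℝ) (c : ι → ℝ)
    (M : ι → Matrix (Fin 2) (Fin 2) ℝ) :
    polar β (∑ i ∈ s, c i • M i) = ∑ i ∈ s, c i * polar β (M i) := by
  classical
  induction s using Finset.cons_induction with
  | empty => simp [polar_zero_right]
  | cons a s ha ih => rw [Finset.sum_cons, Finset.sum_cons, polar_add_right, polar_smul_right, ih]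

/-- `polar 1 P = tr P / 2`: the identity is the test matrix that reads the trace. [folklore] -/
theorem polar_one_left (P : Matrix (Fin 2) (Fin 2) ℝ) : polar 1 P = P.trace / 2 := by
  rw [polar_apply, Matrix.trace_fin_two]
  simp [Matrix.one_apply_ne]
  ring

/-- **Pairing the balance with a test matrix.**  If the six matrix balance equations
`Σ_j (μ_j κ_j e^{δ_l τ_j}) • P(τ_j) = 0` hold, then for every test matrix `β` the scalar vector
`j ↦ μ_j κ_j · polar(β, P(τ_j))` is a kernel vector of the exponential point evaluations:
`Σ_j (μ_j κ_j polar(β,P(τ_j))) e^{δ_l τ_j} = 0` for every `l`. [this work] -/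
theorem balance_pairing (δ : Fin 6 → ℝ) (S : Fin 6 → Matrix (Fin 2) (Fin 2) ℝ) (τ : Fin 21 → ℝ)
    (κ μ : Fin 21 → ℝ)
    (hμ : ∀ l, ∑ j, (μ j * κ j * Real.exp (δ l * τ j)) • (∑ l', Real.exp (δ l' * τ j) • S l') = 0)
    (β : Matrix (Fin 2) (Fin 2) ℝ) (l : Fin 6) :
    ∑ j, (μ j * κ j * polar β (∑ l', Real.exp (δ l' * τ j) • S l')) * Real.exp (δ l * τ j) = 0 := by
  have h := congrArg (polar β) (hμ l)
  rw [polar_sum_smul] at h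
  have h0 : polar β (0 : Matrix (Fin 2) (Fin 2) ℝ) = 0 := by rw [polar_apply]; simp
  rw [h0] at h
  rw [← h]
  refine Finset.sum_congr rfl fun j _ => by ring

/-- The pencil value `P(t) = Σ_l e^{δ_l t} S_l` read through a test matrix is a six-term exponential sum:
`polar(β, P(t)) = Σ_l polar(β, S_l) e^{δ_l t}`. [folklore] -/
theorem polar_expPencil (δ : Fin 6 → ℝ) (S : Fin 6 → Matrix (Fin 2) (Fin 2) ℝ) (β : Matrix (Fin 2) (Fin 2) ℝ) (t : ℝ) :
    polar β (∑ l, Real.exp (δ l * t) • S l) = ∑ l, polar β (S l) * Real.exp (δ l * t) := by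
  rw [polar_sum_smul]
  refine Finset.sum_congr rfl fun l _ => by ring

/-! ## §2 Null letters: proportionality and the Lorentz cross product -/

/-- **Orthogonal null letters are proportional.**  Two singular symmetric `2 × 2` matrices `p, q` with `tr p ≠ 0` and
`polar(p,q) = 0` satisfy `q = c • p` (two null vectors of `ℝ^{1,2}` are orthogonal iff parallel). [folklore] -/
theorem exists_eq_smul_of_polar_eq_zero (p q : Matrix (Fin 2) (Fin 2) ℝ) (hp : p 1 0 = p 0 1) (hq : q 1 0 = q 0 1)
    (hpd : p.det = 0) (hpt : p.trace ≠ 0) (hqd : q.det = 0) (h : polar p q = 0) : ∃ c : ℝ, q = c • p := by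
  rw [Matrix.det_fin_two, hp] at hpd
  rw [Matrix.det_fin_two, hq] at hqd
  rw [Matrix.trace_fin_two] at hpt
  rw [polar_apply, hp, hq] at h
  by_cases h00 : p 0 0 = 0
  · -- then `p 0 1 = 0`, `p 1 1 ≠ 0`, and `q` is a multiple of `E₁₁`
    have h01 : p 0 1 = 0 := by
      have : p 0 1 * p 0 1 = 0 := by rw [h00] at hpd; linarith
      exact mul_self_eq_zero.1 this
    have h11 : p 1 1 ≠ 0 := by intro h11; exact hpt (by rw [h00, h11, add_zero])
    have hq00 : q 0 0 = 0 := by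
      have : p 1 1 * q 0 0 = 0 := by rw [h00, h01] at h; linarith
      rcases mul_eq_zero.1 this with h' | h'
      · exact absurd h' h11
      · exact h'
    have hq01 : q 0 1 = 0 := by
      have : q 0 1 * q 0 1 = 0 := by rw [hq00] at hqd; linarith
      exact mul_self_eq_zero.1 this
    refine ⟨q 1 1 / p 1 1, ?_⟩
    rw [← Matrix.ext_iff]
    simp only [Fin.forall_fin_two, Matrix.smul_apply, smul_eq_mul]
    refine ⟨⟨?_, ?_⟩, ?_, ?_⟩
    · rw [hq00, h00, mul_zero]
    · rw [hq01, h01, mul_zero]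
    · rw [hq, hp, hq01, h01, mul_zero]
    · field_simp
  · refine ⟨q 0 0 / p 0 0, ?_⟩
    -- `(p₀₀ q₀₁ − p₀₁ q₀₀)² = 0`
    have hsq : (p 0 0 * q 0 1 - p 0 1 * q 0 0) ^ 2 = 0 := by
      linear_combination (-(p 0 0) ^ 2) * hqd - (q 0 0) ^ 2 * hpd + (2 * p 0 0 * q 0 0) * h
    have h1 : p 0 0 * q 0 1 = p 0 1 * q 0 0 := by
      have := pow_eq_zero_iff (n := 2) (by norm_num) |>.1 hsq
      linarith
    have h2 : p 0 0 * (p 0 0 * q 1 1 - q 0 0 * p 1 1) = 0 := by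
      linear_combination (2 * p 0 0) * h - (2 * q 0 0) * hpd + (2 * p 0 1) * h1
    have h3 : p 0 0 * q 1 1 = q 0 0 * p 1 1 := by
      rcases mul_eq_zero.1 h2 with h' | h'
      · exact absurd h' h00
      · linarith
    rw [← Matrix.ext_iff]
    simp only [Fin.forall_fin_two, Matrix.smul_apply, smul_eq_mul]
    refine ⟨⟨?_, ?_⟩, ?_, ?_⟩
    · field_simp
    · field_simp; linarith
    · rw [hq, hp]; field_simp; linarith
    · field_simp; linarith

/-- **A letter orthogonal to the three test matrices of a null letter is proportional to it.**  For a singular symmetric `p`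
with `tr p ≠ 0`, the test matrices `β¹ = !![2p₀₁, p₁₁; p₁₁, 0]`, `β² = !![0, p₀₀; p₀₀, 2p₀₁]` and `p` itself are
`polar`-orthogonal to `p`; a symmetric `S` orthogonal to all three is `s • p` (the orthogonal complement of the tangent
plane `p^⊥` of the null cone is the null line `ℝp`). [folklore] -/
theorem exists_eq_smul_of_three_polar (p S : Matrix (Fin 2) (Fin 2) ℝ) (hp : p 1 0 = p 0 1) (hS : S 1 0 = S 0 1)
    (hpd : p.det = 0) (hpt : p.trace ≠ 0)
    (h1 : polar !![2 * p 0 1, p 1 1; p 1 1, 0] S = 0) (h2 : polar !![0, p 0 0; p 0 0, 2 * p 0 1] S = 0)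
    (h3 : polar p S = 0) : ∃ s : ℝ, S = s • p := by
  rw [Matrix.det_fin_two, hp] at hpd
  rw [Matrix.trace_fin_two] at hpt
  rw [polar_apply, hS] at h1 h2 h3
  simp only [Matrix.of_apply, Matrix.cons_val', Matrix.cons_val_zero, Matrix.cons_val_one,
    Matrix.empty_val', Matrix.cons_val_fin_one] at h1 h2
  rw [hp] at h3
  -- h1 : p₀₁ S₁₁ = p₁₁ S₀₁ ; h2 : p₀₁ S₀₀ = p₀₀ S₀₁ ; h3 : p₀₀ S₁₁ + p₁₁ S₀₀ = 2 p₀₁ S₀₁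
  by_cases h00 : p 0 0 = 0
  · have h01 : p 0 1 = 0 := by
      have : p 0 1 * p 0 1 = 0 := by rw [h00] at hpd; linarith
      exact mul_self_eq_zero.1 this
    have h11 : p 1 1 ≠ 0 := by intro h11; exact hpt (by rw [h00, h11, add_zero])
    have hS01 : S 0 1 = 0 := by
      have : p 1 1 * S 0 1 = 0 := by rw [h01] at h1; linarith
      rcases mul_eq_zero.1 this with h' | h'
      · exact absurd h' h11
      · exact h'
    have hS00 : S 0 0 = 0 := by
      have : p 1 1 * S 0 0 = 0 := by rw [h00, h01] at h3; linarith
      rcases mul_eq_zero.1 this with h' | h'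
      · exact absurd h' h11
      · exact h'
    refine ⟨S 1 1 / p 1 1, ?_⟩
    rw [← Matrix.ext_iff]
    simp only [Fin.forall_fin_two, Matrix.smul_apply, smul_eq_mul]
    refine ⟨⟨?_, ?_⟩, ?_, ?_⟩
    · rw [hS00, h00, mul_zero]
    · rw [hS01, h01, mul_zero]
    · rw [hS, hp, hS01, h01, mul_zero]
    · field_simp
  · refine ⟨S 0 0 / p 0 0, ?_⟩
    have e2 : p 0 0 * S 0 1 = p 0 1 * S 0 0 := by linarith
    have e3 : p 0 0 * (p 0 0 * S 1 1 - S 0 0 * p 1 1) = 0 := by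
      linear_combination (2 * p 0 0) * h3 - (2 * S 0 0) * hpd + (2 * p 0 1) * e2
    have e4 : p 0 0 * S 1 1 = S 0 0 * p 1 1 := by
      rcases mul_eq_zero.1 e3 with h' | h'
      · exact absurd h' h00
      · linarith
    rw [← Matrix.ext_iff]
    simp only [Fin.forall_fin_two, Matrix.smul_apply, smul_eq_mul]
    refine ⟨⟨?_, ?_⟩, ?_, ?_⟩
    · field_simp
    · field_simp; linarith
    · rw [hS, hp]; field_simp; linarith
    · field_simp; linarith

/-- The two explicit test matrices and `p` itself are `polar`-orthogonal to the singular symmetric letter `p`. [folklore] -/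
theorem three_polar_self (p : Matrix (Fin 2) (Fin 2) ℝ) (hp : p 1 0 = p 0 1) (hpd : p.det = 0) :
    polar !![2 * p 0 1, p 1 1; p 1 1, 0] p = 0 ∧ polar !![0, p 0 0; p 0 0, 2 * p 0 1] p = 0 ∧ polar p p = 0 := by
  rw [Matrix.det_fin_two, hp] at hpd
  refine ⟨?_, ?_, ?_⟩
  · rw [polar_apply, hp]
    simp only [Matrix.of_apply, Matrix.cons_val', Matrix.cons_val_zero, Matrix.cons_val_one,
      Matrix.empty_val', Matrix.cons_val_fin_one]
    ring
  · rw [polar_apply, hp]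
    simp only [Matrix.of_apply, Matrix.cons_val', Matrix.cons_val_zero, Matrix.cons_val_one,
      Matrix.empty_val', Matrix.cons_val_fin_one]
    ring
  · rw [polar_apply, hp]; linarith

/-- **The Lorentz cross product.**  For symmetric `p, q` the symmetric matrix
`β(p,q) = !![2(p₀₀q₀₁ − p₀₁q₀₀), p₀₀q₁₁ − p₁₁q₀₀; p₀₀q₁₁ − p₁₁q₀₀, 2(p₀₁q₁₁ − p₁₁q₀₁)]` is `polar`-orthogonal to `p` and
to `q` (it spans the orthogonal complement of the plane `span(p,q)` in `(Sym₂ℝ, det) ≅ ℝ^{1,2}`). [folklore] -/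
theorem polar_cross_left_right (p q : Matrix (Fin 2) (Fin 2) ℝ) (hp : p 1 0 = p 0 1) (hq : q 1 0 = q 0 1) :
    polar !![2 * (p 0 0 * q 0 1 - p 0 1 * q 0 0), p 0 0 * q 1 1 - p 1 1 * q 0 0;
        p 0 0 * q 1 1 - p 1 1 * q 0 0, 2 * (p 0 1 * q 1 1 - p 1 1 * q 0 1)] p = 0 ∧
    polar !![2 * (p 0 0 * q 0 1 - p 0 1 * q 0 0), p 0 0 * q 1 1 - p 1 1 * q 0 0;
        p 0 0 * q 1 1 - p 1 1 * q 0 0, 2 * (p 0 1 * q 1 1 - p 1 1 * q 0 1)] q = 0 := by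
  constructor <;>
  · simp only [polar_apply, hp, hq, Matrix.of_apply, Matrix.cons_val', Matrix.cons_val_zero, Matrix.cons_val_one,
      Matrix.empty_val', Matrix.cons_val_fin_one]
    ring

/-- **Gram identity for the cross product** (the `3 × 3` Gram determinant of `p, q, r` in `(Sym₂ℝ, polar)` is a quarter of
the square of the coordinate determinant, and `polar(β(p,q), r)` IS that determinant):
`polar(β(p,q), r)² = 8·polar(p,q)·polar(q,r)·polar(r,p) + 4·(det p·det q·det r − det p·polar(q,r)² − det q·polar(r,p)²
− det r·polar(p,q)²)`. [folklore] -/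
theorem polar_cross_sq (p q r : Matrix (Fin 2) (Fin 2) ℝ) (hp : p 1 0 = p 0 1) (hq : q 1 0 = q 0 1)
    (hr : r 1 0 = r 0 1) :
    (polar !![2 * (p 0 0 * q 0 1 - p 0 1 * q 0 0), p 0 0 * q 1 1 - p 1 1 * q 0 0;
        p 0 0 * q 1 1 - p 1 1 * q 0 0, 2 * (p 0 1 * q 1 1 - p 1 1 * q 0 1)] r) ^ 2 =
      8 * polar p q * polar q r * polar r p +
        4 * (p.det * q.det * r.det - p.det * (polar q r) ^ 2 - q.det * (polar r p) ^ 2 - r.det * (polar p q) ^ 2) := by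
  simp only [polar_apply, Matrix.det_fin_two, hp, hq, hr, Matrix.of_apply, Matrix.cons_val', Matrix.cons_val_zero,
    Matrix.cons_val_one, Matrix.empty_val', Matrix.cons_val_fin_one]
  ring

/-- **KEY: a null letter orthogonal to the cross product of two non-orthogonal null letters is parallel to one of them.**
If `p, q, r` are singular symmetric, `polar(p,q) ≠ 0` and `polar(β(p,q), r) = 0`, then `polar(q,r) = 0` or `polar(r,p) = 0`
(the plane `span(p,q)` contains exactly the two null lines `ℝp`, `ℝq`). [folklore] -/
theorem polar_eq_zero_or_of_cross (p q r : Matrix (Fin 2) (Fin 2) ℝ) (hp : p 1 0 = p 0 1) (hq : q 1 0 = q 0 1)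
    (hr : r 1 0 = r 0 1) (hpd : p.det = 0) (hqd : q.det = 0) (hrd : r.det = 0) (hpq : polar p q ≠ 0)
    (h : polar !![2 * (p 0 0 * q 0 1 - p 0 1 * q 0 0), p 0 0 * q 1 1 - p 1 1 * q 0 0;
        p 0 0 * q 1 1 - p 1 1 * q 0 0, 2 * (p 0 1 * q 1 1 - p 1 1 * q 0 1)] r = 0) :
    polar q r = 0 ∨ polar r p = 0 := by
  have hsq := polar_cross_sq p q r hp hq hr
  rw [h, hpd, hqd, hrd] at hsq
  have : polar p q * (polar q r * polar r p) = 0 := by nlinarith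
  rcases mul_eq_zero.1 this with h' | h'
  · exact absurd h' hpq
  · exact mul_eq_zero.1 h'

/-! ## §3 Exponential sums with `K` zeros; seven parallel touches are impossible -/

/-- **A `K`-term real exponential sum with `K` distinct zeros vanishes identically** (coefficient by coefficient): the
coefficient vector is a left kernel vector of the non-singular matrix `(e^{δ_l z_m})` (`det_exp_ne_zero`). [folklore] -/
theorem expCoeff_eq_zero_of_zeros {K : ℕ} (δ : Fin K → ℝ) (hδ : Function.Injective δ) (z : Fin K → ℝ)
    (hz : Function.Injective z) (c : Fin K → ℝ) (h : ∀ m, ∑ l, c l * Real.exp (δ l * z m) = 0) : c = 0 := by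
  classical
  by_contra hc
  have hdet := det_exp_ne_zero δ z hδ hz
  have hker : Matrix.vecMul c (Matrix.of fun l m => Real.exp (δ l * z m)) = 0 := by
    funext m
    simp only [Matrix.vecMul, dotProduct, Matrix.of_apply, Pi.zero_apply]
    exact h m
  exact hdet (Matrix.exists_vecMul_eq_zero_iff.1 ⟨c, hc, hker⟩)

/-- **SEVEN PAIRWISE-PARALLEL TOUCHES ARE IMPOSSIBLE** (in fact six).  Strictly increasing exponents and abscissae, symmetric
letters, some abscissa `j₀` with `det P(τ_{j₀}) ≠ 0`; if at the abscissae of a set `T` with `6 ≤ |T|` the pencil values are all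
multiples of ONE singular symmetric matrix `p` with `tr p ≠ 0`, contradiction: for each of the three test matrices `β ⊥ p` the
six-term sum `t ↦ polar(β, P(t))` has six zeros, so `polar(β, S_l) = 0` for every letter, every letter is a multiple of `p`
(`exists_eq_smul_of_three_polar`), and `det P ≡ 0`. [this work] -/
theorem false_of_parallel_touches (δ : Fin 6 → ℝ) (hd : StrictMono δ) (S : Fin 6 → Matrix (Fin 2) (Fin 2) ℝ)
    (hS : ∀ l, (S l).IsSymm) (τ : Fin 21 → ℝ) (hτ : StrictMono τ) (j₀ : Fin 21)
    (hj₀ : (∑ l, Real.exp (δ l * τ j₀) • S l).det ≠ 0)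
    (p : Matrix (Fin 2) (Fin 2) ℝ) (hp : p 1 0 = p 0 1) (hpd : p.det = 0) (hpt : p.trace ≠ 0)
    (T : Finset (Fin 21)) (hT : 6 ≤ T.card) (hpar : ∀ j ∈ T, ∃ c : ℝ, (∑ l, Real.exp (δ l * τ j) • S l) = c • p) :
    False := by
  classical
  obtain ⟨T6, hT6, hcard⟩ := Finset.exists_subset_card_eq hT
  -- six distinct zeros
  let z : Fin 6 → ℝ := fun i => τ (T6.orderEmbOfFin hcard i)
  have hz : Function.Injective z := hτ.injective.comp (T6.orderEmbOfFin hcard).injective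
  have hSsym : ∀ l, (S l) 1 0 = (S l) 0 1 := fun l => (hS l).apply 0 1
  -- every test matrix orthogonal to `p` kills every letter
  have hkill : ∀ β : Matrix (Fin 2) (Fin 2) ℝ, polar β p = 0 → ∀ l, polar β (S l) = 0 := by
    intro β hβ
    have hzero : ∀ m, ∑ l, polar β (S l) * Real.exp (δ l * z m) = 0 := by
      intro m
      rw [← polar_expPencil]
      obtain ⟨c, hc⟩ := hpar _ (hT6 (T6.orderEmbOfFin_mem hcard m))
      show polar β (∑ l, Real.exp (δ l * τ (T6.orderEmbOfFin hcard m)) • S l) = 0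
      rw [hc, polar_smul_right, hβ, mul_zero]
    have := expCoeff_eq_zero_of_zeros δ hd.injective z hz (fun l => polar β (S l)) hzero
    exact fun l => congrFun this l
  obtain ⟨hb1, hb2, hb3⟩ := three_polar_self p hp hpd
  have hprop : ∀ l, ∃ s : ℝ, S l = s • p := fun l =>
    exists_eq_smul_of_three_polar p (S l) hp (hSsym l) hpd hpt (hkill _ hb1 l) (hkill _ hb2 l) (hkill _ hb3 l)
  choose s hs using hprop
  have hP : (∑ l, Real.exp (δ l * τ j₀) • S l) = (∑ l, Real.exp (δ l * τ j₀) * s l) • p := by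
    rw [Finset.sum_smul]
    refine Finset.sum_congr rfl fun l _ => ?_
    rw [hs l, smul_smul]
  apply hj₀
  rw [hP, Matrix.det_smul, hpd, mul_zero]

end Summit.ValiantsHypothesis.ValiantsHypothesis.Theorems.LacunarySymmetroidMatrixDescartes.WallBubbling
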